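import Literature.AlgebraicGeometry.Motives.MiddleConvolutionMul
import HarnessLib

/-!
# Middle convolution `MC_λ` preserves irreducibility ([DettweilerReiter2007, Thm. 2.4 (iii)]) — proofs

This file proves the irreducibility statement of Dettweiler–Reiter for Katz's middle convolution
in the algebraic model of `Literature.AlgebraicGeometry.Motives.MiddleConvolution`:

* `MiddleConvolution.isIrreducible_middleConvolution`: for a finite-dimensional module `V` over the
  free group `F_ι` on a **nonempty** finite ordered set of generators over a field `K`, satisfying
  condition `(∗)` (`CondStar`), if `V` is irreducible then `MC_λ(V)` is irreducible for every
  `λ ∈ Kˣ` ([DettweilerReiter2007, Thm. 2.4 (iii)] = [DettweilerReiter2000, Cor. 3.6]; Katz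
  [Katz1996, Thm. 2.9.8]).
* `not_DettweilerReiter2007_irreducible`: the named fact `DettweilerReiter2007_irreducible` of the
  companion file is **mis-stated**: it quantifies over all `r : ℕ`, and for `r = 0` (no generators)
  the one-dimensional module `V = K` of the trivial group `F_0` is irreducible and satisfies `(∗)`,
  `(∗∗)` vacuously, while `MC_λ(V) = V^0 ⧸ _ = 0` is not irreducible (Mathlib's
  `Representation.IsIrreducible` = `IsSimpleOrder (Subrepresentation _)` excludes the zero module).
  The source has `r ≥ 1` implicitly ("the free group on `r` generators `f_1, …, f_r`").

## The proof

The printed proof ([DettweilerReiter2000, Cor. 3.6], to which [DettweilerReiter2007] refers) goes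
through the multiplicativity `MC_{λ⁻¹} ∘ MC_λ ≅ id` ([DettweilerReiter2000, Thm. 3.5], the unproved
named fact `DettweilerReiter2007_mul`).  We do NOT follow it: the direction "`V` irreducible ⟹
`MC_λ(V)` irreducible" has the following direct proof, which uses only `(∗)` (for an irreducible `V`
the conditions `(∗)` and `(∗∗)` are equivalent, [DettweilerReiter2000, Rem. 3.1]).

Write `B_k v = v + ι_k(D_k v)` with the `k`-th defect `D_k` (`MiddleConvolution.defect`; the
defect calculus of `Literature.AlgebraicGeometry.Motives.MiddleConvolutionMul` is reused) and the
`k`-th coordinate embedding `ι_k = Pi.single k`.  Let `M ≤ V^ι` be `B`-stable with `𝒦 + ℒ ≤ M`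
(the preimage of a subrepresentation of `MC_λ(V)`), and `N_k = ι_k⁻¹(M)`.  Then
`ker(A_k - 1) ≤ N_k`, `D_k(M) ≤ N_k` (as `ι_k D_k v = B_k v - v`), `(A_j - 1) N_j ≤ N_k` for `j ≠ k`
and `A_k N_k ≤ N_k` (evaluate `D_k` on `ι_j x`).  Hence `W = Σ_j (A_j - 1) N_j` is an
`F_ι`-submodule of `V` contained in every `N_k`; so `W = V` forces `M = V^ι`, and `W = 0` forces
`D_k v ∈ ker(A_k - 1)` for `v ∈ M`, whence `v ∈ 𝒦 + ℒ` (for `λ ≠ 1` subtract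
`κ = ((λ-1)⁻¹ D_k v)_k ∈ 𝒦`; for `λ = 1` the defect is independent of `k` and `(∗)` kills it).
Non-vanishing of `MC_λ(V)`: if `𝒦 + ℒ = V^ι` then every `ι_k x` lies in `𝒦 + ℒ`, so
(`MiddleConvolution.single_mem_kerSum_iff`, which is `(∗)` at `(k, λ)`) every `A_k = 1`,
contradicting `(∗)` at `τ = 1`.
-/

noncomputable section

namespace Literature.AlgebraicGeometry.Motives

namespace MiddleConvolution

/-! ### `B`-stable subspaces of `V^ι` and the subspaces `N_k = ι_k⁻¹(M)` -/

section Stable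

variable {K : Type*} [Field K] {V : Type*} [AddCommGroup V] [Module K V]
variable {ι : Type*} [Fintype ι] [LinearOrder ι]
variable {ρ : Representation K (FreeGroup ι) V} {l : Kˣ} {M : Submodule K (ι → V)}

/-- If `M ≤ V^ι` is stable under every `B_k`, then `ι_k (D_k v) = B_k v - v ∈ M` for `v ∈ M`
(`D_k(M) ≤ N_k`). [folklore] -/
theorem single_defect_mem (hM : ∀ k, ∀ v ∈ M, convolutionEnd (tuple ρ) (l : K) k v ∈ M)
    {v : ι → V} (hv : v ∈ M) (k : ι) : Pi.single k (defect (tuple ρ) (l : K) v k) ∈ M := by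
  rw [← convolutionEnd_sub_self]
  exact M.sub_mem (hM k v hv) hv

/-- `(A_j - 1) N_j ≤ N_k` for `j ≠ k`. [folklore] -/
theorem single_sub_mem_of_ne (hM : ∀ k, ∀ v ∈ M, convolutionEnd (tuple ρ) (l : K) k v ∈ M)
    {j k : ι} (hjk : j ≠ k) {x : V} (hx : Pi.single j x ∈ M) :
    Pi.single k (ρ (FreeGroup.of j) x - x) ∈ M := by
  have h := single_defect_mem hM hx k
  rw [defect_single_of_ne _ _ hjk] at h
  unfold coeff at h
  split_ifs at h
  · rw [LinearMap.smul_apply, Pi.single_smul] at h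
    have h' := (M.smul_mem_iff l.ne_zero).1 h
    rw [LinearMap.sub_apply, Module.End.one_apply] at h'
    exact h'
  · rw [LinearMap.sub_apply, Module.End.one_apply] at h
    exact h

/-- `A_k N_k ≤ N_k`. [folklore] -/
theorem single_apply_mem (hM : ∀ k, ∀ v ∈ M, convolutionEnd (tuple ρ) (l : K) k v ∈ M)
    {k : ι} {x : V} (hx : Pi.single k x ∈ M) : Pi.single k (ρ (FreeGroup.of k) x) ∈ M := by
  have h := single_defect_mem hM hx k
  rw [defect_single_self] at h
  have h2 := M.add_mem h hx
  rw [← Pi.single_add, sub_add_cancel, Pi.single_smul] at h2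
  exact (M.smul_mem_iff l.ne_zero).1 h2

/-- **Key dichotomy.**  Let `V` be a finite-dimensional irreducible `F_ι`-module satisfying `(∗)` and
let `M ≤ V^ι` be a subspace containing `𝒦 + ℒ` and stable under all `B_k` (equivalently: the
preimage of a subrepresentation of `MC_λ(V)`).  Then `M = 𝒦 + ℒ` or `M = V^ι`.  (Direct argument via
`W = Σ_j (A_j - 1) ι_j⁻¹(M)`, see the module docstring; `(∗)` is used only when `λ = 1`.)
[cite: DettweilerReiter2007, Theorem 2.4 (iii)] -/
theorem eq_kerSum_or_eq_top [FiniteDimensional K V] (hstar : CondStar ρ) (hirr : ρ.IsIrreducible)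
    (hle : kerSum ρ l ≤ M) (hM : ∀ k, ∀ v ∈ M, convolutionEnd (tuple ρ) (l : K) k v ∈ M) :
    M = kerSum ρ l ∨ M = ⊤ := by
  haveI : IsSimpleOrder (Subrepresentation ρ) := hirr
  -- the subspace `W = Σ_j (A_j - 1) N_j`, `N_j = ι_j⁻¹(M)`
  set W : Submodule K V := Submodule.span K
    {y | ∃ (j : ι) (x : V), Pi.single j x ∈ M ∧ y = ρ (FreeGroup.of j) x - x} with hW
  -- (W1) `W ≤ N_k` for every `k`
  have hW1 : ∀ k, ∀ y ∈ W, Pi.single k y ∈ M := by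
    intro k
    have hWle : W ≤ M.comap (LinearMap.single K (fun _ : ι => V) k) := by
      rw [hW]
      refine Submodule.span_le.2 ?_
      rintro y ⟨j, x, hx, rfl⟩
      simp only [SetLike.mem_coe, Submodule.mem_comap, LinearMap.coe_single]
      rcases eq_or_ne j k with rfl | hjk
      · rw [Pi.single_sub]
        exact M.sub_mem (single_apply_mem hM hx) hx
      · exact single_sub_mem_of_ne hM hjk hx
    exact fun y hy => hWle hy
  -- (W2) `W` is stable under every `A_i`
  have hW2 : ∀ i, ∀ y ∈ W, ρ (FreeGroup.of i) y ∈ W := by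
    intro i
    have hmap : W.map (ρ (FreeGroup.of i)) ≤ W := by
      rw [hW, Submodule.map_span_le]
      rintro y ⟨j, x, hx, rfl⟩
      rcases eq_or_ne j i with rfl | hji
      · -- `A_j (A_j x - x) = A_j (A_j x) - A_j x` with `ι_j (A_j x) ∈ M`
        rw [map_sub]
        exact Submodule.subset_span ⟨j, _, single_apply_mem hM hx, rfl⟩
      · -- `z = A_j x - x` has `ι_i z ∈ M`, and `A_i z = (A_i z - z) + z`
        have hz : Pi.single i (ρ (FreeGroup.of j) x - x) ∈ M := single_sub_mem_of_ne hM hji hx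
        rw [← sub_add_cancel (ρ (FreeGroup.of i) (ρ (FreeGroup.of j) x - x))
          (ρ (FreeGroup.of j) x - x)]
        exact Submodule.add_mem _ (Submodule.subset_span ⟨i, _, hz, rfl⟩)
          (Submodule.subset_span ⟨j, x, hx, rfl⟩)
    exact fun y hy => hmap (Submodule.mem_map_of_mem hy)
  -- (W3) `W` is stable under the inverses `A_i⁻¹` (finite dimension)
  have hW3 : ∀ i, ∀ y ∈ W, ρ (FreeGroup.of i)⁻¹ y ∈ W := by
    intro i y hy
    have hli : Function.LeftInverse (ρ (FreeGroup.of i)⁻¹) (ρ (FreeGroup.of i)) := fun v => by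
      rw [← Module.End.mul_apply, ← map_mul, inv_mul_cancel, map_one, Module.End.one_apply]
    have hmaple : W.map (ρ (FreeGroup.of i)) ≤ W :=
      Submodule.map_le_iff_le_comap.2 fun z hz => Submodule.mem_comap.2 (hW2 i z hz)
    have heq : W.map (ρ (FreeGroup.of i)) = W :=
      Submodule.eq_of_le_of_finrank_le hmaple
        (Submodule.equivMapOfInjective _ hli.injective W).finrank_eq.le
    rw [← heq] at hy
    obtain ⟨w, hw, rfl⟩ := Submodule.mem_map.1 hy
    rw [hli w]
    exact hw
  -- so `W` is a subrepresentation of the irreducible `ρ`: `W = 0` or `W = V`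
  have hstabW : ∀ g : FreeGroup ι, ∀ y ∈ W, ρ g y ∈ W := by
    intro g
    induction g using FreeGroup.induction_on with
    | C1 => intro y hy; simpa using hy
    | of i => exact hW2 i
    | inv_of i _ => exact hW3 i
    | mul _ _ hg hh =>
      intro y hy
      rw [map_mul, Module.End.mul_apply]
      exact hg _ (hh _ hy)
  have hbot : (⊥ : Subrepresentation ρ).toSubmodule = ⊥ := rfl
  have htop : (⊤ : Subrepresentation ρ).toSubmodule = ⊤ := rfl
  rcases IsSimpleOrder.eq_bot_or_eq_top (⟨W, fun g y hy => hstabW g y hy⟩ : Subrepresentation ρ)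
    with h0 | h1
  · -- `W = 0`: every `x` with `ι_j x ∈ M` is fixed by `A_j`; then `M ≤ 𝒦 + ℒ`
    have hW0 : W = ⊥ := (congrArg Subrepresentation.toSubmodule h0).trans hbot
    have hfix : ∀ (j : ι) (x : V), Pi.single j x ∈ M → ρ (FreeGroup.of j) x = x := by
      intro j x hx
      have hxW : ρ (FreeGroup.of j) x - x ∈ W := by
        rw [hW]
        exact Submodule.subset_span ⟨j, x, hx, rfl⟩
      rw [hW0, Submodule.mem_bot, sub_eq_zero] at hxW
      exact hxW
    left
    refine le_antisymm (fun v hv => ?_) hle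
    -- all defects `D_k v` are fixed by `A_k`, hence `v ∈ 𝒦 + ℒ` (`mem_kerSum_iff`)
    have hd : ∀ k, ρ (FreeGroup.of k) (defect (tuple ρ) (l : K) v k) =
        defect (tuple ρ) (l : K) v k := fun k => hfix k _ (single_defect_mem hM hv k)
    rw [mem_kerSum_iff]
    intro k
    by_cases hc : (l : K) = 1
    · -- `λ = 1`: the defect does not depend on `k` and lies in `⋂_k ker(A_k - 1) = 0` by `(∗)`
      refine ⟨0, map_zero _, ?_⟩
      rw [smul_zero]
      have h1 : ∀ k', defect (tuple ρ) (l : K) v k' = ∑ j, (tuple ρ j (v j) - v j) := fun k' => by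
        rw [hc]
        exact defect_one _ v k'
      have hmem : defect (tuple ρ) (l : K) v k ∈
          (⨅ j ∈ {j | j ≠ k}, LinearMap.ker (tuple ρ j - 1)) ⊓
            LinearMap.ker (((1 : Kˣ) : K) • tuple ρ k - 1) := by
        refine Submodule.mem_inf.2 ⟨?_, ?_⟩
        · refine (Submodule.mem_iInf _).2 fun j => (Submodule.mem_iInf _).2 fun _ => ?_
          rw [LinearMap.mem_ker, LinearMap.sub_apply, Module.End.one_apply, sub_eq_zero, h1 k,
            ← h1 j]
          exact hd j
        · rw [LinearMap.mem_ker, LinearMap.sub_apply, LinearMap.smul_apply, Units.val_one,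
            one_smul, Module.End.one_apply, sub_eq_zero]
          exact hd k
      rw [hstar k 1] at hmem
      exact (Submodule.mem_bot K).1 hmem
    · -- `λ ≠ 1`: `D_k v = (λ - 1) y` with `y = (λ - 1)⁻¹ D_k v ∈ ker(A_k - 1)`
      refine ⟨((l : K) - 1)⁻¹ • defect (tuple ρ) (l : K) v k, ?_, ?_⟩
      · rw [map_smul, hd k]
      · rw [smul_smul, mul_inv_cancel₀ (sub_ne_zero.2 hc), one_smul]
  · -- `W = V`: every `N_k = V`, so `M = V^ι`
    have hWtop : W = ⊤ := (congrArg Subrepresentation.toSubmodule h1).trans htop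
    right
    rw [eq_top_iff]
    intro v _
    rw [← Finset.univ_sum_single v]
    exact M.sum_mem fun k _ => hW1 k (v k) (by rw [hWtop]; exact Submodule.mem_top)

end Stable

/-! ### Non-vanishing and irreducibility of `MC_λ(V)` -/

section Irreducible

variable {K : Type*} [Field K] {V : Type*} [AddCommGroup V] [Module K V]
variable {ι : Type*} [Fintype ι] [LinearOrder ι]
variable (ρ : Representation K (FreeGroup ι) V) (l : Kˣ)

/-- **`MC_λ(V) ≠ 0`** under `(∗)` for `V ≠ 0` and at least one generator: `𝒦 + ℒ ≠ V^ι`.  (If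
`𝒦 + ℒ = V^ι` then every `ι_k x ∈ 𝒦 + ℒ`, so every `A_k = 1` by `(∗)` at `(k, λ)`
(`single_mem_kerSum_iff`), contradicting `(∗)` at `τ = 1`.)
[cite: DettweilerReiter2007, Theorem 2.4 (iii)] -/
theorem kerSum_ne_top [Nontrivial V] [Nonempty ι] (hstar : CondStar ρ) : kerSum ρ l ≠ ⊤ := by
  intro htop'
  -- Step 1: every `ι_k x` lies in `𝒦 + ℒ`, so (`(∗)` at `(k, λ)`) every `A_k` is the identity
  have hA : ∀ (k : ι) (x : V), ρ (FreeGroup.of k) x = x := fun k x =>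
    (single_mem_kerSum_iff ρ l (hstar k l) x).1 (by rw [htop']; exact Submodule.mem_top)
  -- Step 2: then `(∗)` with `τ = 1` says `V = 0`
  obtain ⟨k⟩ := ‹Nonempty ι›
  obtain ⟨x, hx⟩ := exists_ne (0 : V)
  have hmem : x ∈ (⨅ j ∈ {j | j ≠ k}, LinearMap.ker (tuple ρ j - 1)) ⊓
      LinearMap.ker (((1 : Kˣ) : K) • tuple ρ k - 1) := by
    refine Submodule.mem_inf.2 ⟨?_, ?_⟩
    · refine (Submodule.mem_iInf _).2 fun j => (Submodule.mem_iInf _).2 fun _ => ?_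
      rw [LinearMap.mem_ker, LinearMap.sub_apply, Module.End.one_apply, sub_eq_zero]
      exact hA j x
    · rw [LinearMap.mem_ker, LinearMap.sub_apply, LinearMap.smul_apply, Units.val_one, one_smul,
        Module.End.one_apply, sub_eq_zero]
      exact hA k x
  rw [hstar k 1] at hmem
  exact hx ((Submodule.mem_bot K).1 hmem)

/-- **`MC_λ` preserves irreducibility** ([DettweilerReiter2007, Thm. 2.4 (iii)] =
[DettweilerReiter2000, Cor. 3.6], the algebraic counterpart of [Katz1996, Thm. 2.9.8]): for a
finite-dimensional module `V` over the free group on a nonempty finite ordered set `ι` of generators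
over a field `K`, satisfying `(∗)`, if `V` is irreducible then so is `MC_λ(V)`, for every `λ ∈ Kˣ`.
(The printed hypothesis `(∗∗)` is not needed: for irreducible `V` it is equivalent to `(∗)`,
[DettweilerReiter2000, Rem. 3.1].) [cite: DettweilerReiter2007, Theorem 2.4 (iii)] -/
theorem isIrreducible_middleConvolution [FiniteDimensional K V] [Nonempty ι] (hstar : CondStar ρ)
    (hirr : ρ.IsIrreducible) : (middleConvolution ρ l).IsIrreducible := by
  haveI : IsSimpleOrder (Subrepresentation ρ) := hirr
  -- `V ≠ 0`
  have hbt : (⊥ : Subrepresentation ρ) ≠ ⊤ := IsSimpleOrder.bot_ne_top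
  haveI : Nontrivial V := by
    by_contra hV
    haveI : Subsingleton V := not_nontrivial_iff_subsingleton.1 hV
    haveI : Subsingleton (Submodule K V) := (Submodule.subsingleton_iff K).2 ‹_›
    exact hbt (Subrepresentation.toSubmodule_injective (Subsingleton.elim _ _))
  -- `MC_λ(V) ≠ 0`
  haveI : Nontrivial (Space ρ l) :=
    Submodule.Quotient.nontrivial_iff.2 (kerSum_ne_top ρ l hstar)
  have hbot : (⊥ : Subrepresentation (middleConvolution ρ l)).toSubmodule = ⊥ := rfl
  have htop : (⊤ : Subrepresentation (middleConvolution ρ l)).toSubmodule = ⊤ := rfl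
  haveI : Nontrivial (Subrepresentation (middleConvolution ρ l)) :=
    ⟨⟨⊥, ⊤, fun h => bot_ne_top (hbot.symm.trans ((congrArg Subrepresentation.toSubmodule h).trans
      htop))⟩⟩
  refine ⟨fun M => ?_⟩
  -- pull a subrepresentation back to a `B`-stable subspace of `V^ι` containing `𝒦 + ℒ`
  set Mt : Submodule K (ι → V) := M.toSubmodule.comap (kerSum ρ l).mkQ with hMt
  have hle : kerSum ρ l ≤ Mt := by
    intro v hv
    have h0 : (kerSum ρ l).mkQ v = 0 := by simpa using hv
    rw [hMt, Submodule.mem_comap, h0]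
    exact M.toSubmodule.zero_mem
  have hMstab : ∀ k, ∀ v ∈ Mt, convolutionEnd (tuple ρ) (l : K) k v ∈ Mt := by
    intro k v hv
    rw [hMt, Submodule.mem_comap, Submodule.mkQ_apply] at hv ⊢
    rw [← middleConvolution_of_mk]
    exact M.apply_mem_toSubmodule (FreeGroup.of k) hv
  have hmap : M.toSubmodule = Mt.map (kerSum ρ l).mkQ :=
    (Submodule.map_comap_eq_of_surjective (Submodule.mkQ_surjective _) _).symm
  rcases eq_kerSum_or_eq_top hstar hirr hle hMstab with h | h
  · left
    apply Subrepresentation.toSubmodule_injective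
    rw [hbot, hmap, h, Submodule.mkQ_map_self]
  · right
    apply Subrepresentation.toSubmodule_injective
    rw [htop, hmap, h, Submodule.map_top, Submodule.range_mkQ]

end Irreducible

end MiddleConvolution

/-! ### The named fact `DettweilerReiter2007_irreducible` is mis-stated (`r = 0`) -/

section NamedFacts

open MiddleConvolution

-- `linter.deprecated` off for this one declaration: the statement it refutes is retired
-- (`@[deprecated]`, no longer literature debt) precisely BECAUSE of this theorem, which must name it.
set_option linter.deprecated false in
/-- **The vendored statement `DettweilerReiter2007_irreducible` is false as written** (refuted in
universes `0, 0`): it quantifies over all numbers `r` of generators, and for `r = 0` the trivial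
one-dimensional module `V = ℚ` of `F_0 = 1` is irreducible and satisfies `(∗)`, `(∗∗)` vacuously,
but `MC_λ(V) = V^0 ⧸ (𝒦 + ℒ) = 0` is not irreducible (`Representation.IsIrreducible` requires a
nonzero module).  The source [DettweilerReiter2007, Thm. 2.4 (iii)] implicitly has `r ≥ 1`
("the free group on `r` generators `f_1, …, f_r`"); the statement for `0 < r` is
`MiddleConvolution.isIrreducible_middleConvolution`. [cite: DettweilerReiter2007, Theorem 2.4 (iii)] -/
theorem not_DettweilerReiter2007_irreducible : ¬ DettweilerReiter2007_irreducible.{0, 0} := by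
  intro h
  obtain ⟨ρ⟩ : Nonempty (Representation ℚ (FreeGroup (Fin 0)) ℚ) :=
    ⟨Representation.trivial ℚ (FreeGroup (Fin 0)) ℚ⟩
  have hbot : (⊥ : Subrepresentation ρ).toSubmodule = ⊥ := rfl
  have htop : (⊤ : Subrepresentation ρ).toSubmodule = ⊤ := rfl
  -- a one-dimensional module is irreducible
  have hirr : ρ.IsIrreducible := by
    haveI : Nontrivial (Subrepresentation ρ) :=
      ⟨⟨⊥, ⊤, fun h' => bot_ne_top (hbot.symm.trans ((congrArg Subrepresentation.toSubmodule
        h').trans htop))⟩⟩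
    refine ⟨fun M => ?_⟩
    rcases Ideal.eq_bot_or_top M.toSubmodule with h' | h'
    · exact Or.inl (Subrepresentation.toSubmodule_injective (h'.trans hbot.symm))
    · exact Or.inr (Subrepresentation.toSubmodule_injective (h'.trans htop.symm))
  have hMC : (middleConvolution ρ 1).IsIrreducible :=
    h ℚ ℚ 0 ρ 1 (fun i => i.elim0) (fun i => i.elim0) hirr
  -- but `MC_1(V) = V^0 ⧸ _` is the zero module
  haveI : Subsingleton (Space ρ 1) := ⟨fun a b => by
    induction a using Submodule.Quotient.induction_on with
    | H a =>
      induction b using Submodule.Quotient.induction_on with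
      | H b => rw [Subsingleton.elim a b]⟩
  haveI : Subsingleton (Submodule ℚ (Space ρ 1)) := (Submodule.subsingleton_iff ℚ).2 ‹_›
  haveI : IsSimpleOrder (Subrepresentation (middleConvolution ρ 1)) := hMC
  exact (IsSimpleOrder.bot_ne_top (α := Subrepresentation (middleConvolution ρ 1)))
    (Subrepresentation.toSubmodule_injective (Subsingleton.elim _ _))

/-! ### The corrected named fact ([DettweilerReiter2007, Thm. 2.4 (iii)] with `r ≥ 1`) -/

universe v w

/-- **`MC_λ` preserves irreducibility** — NAMED FACT (corrected form of
`DettweilerReiter2007_irreducible`, discharged by `DettweilerReiter2007_irreducible_pos_holds`)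
[DettweilerReiter2007, Thm. 2.4 (iii)] (= [DettweilerReiter2000, Cor. 3.6]; Katz [Katz1996,
Thm. 2.9.8]): for a finite-dimensional module `V` over the free group `F_r` on `r ≥ 1` generators
`f_1, …, f_r` over a field `K`, satisfying `(∗)` and `(∗∗)`, if `V` is irreducible then `MC_λ(V)` is
irreducible for every `λ ∈ Kˣ`.  This differs from `DettweilerReiter2007_irreducible` exactly by the
hypothesis `0 < r`, which the source carries implicitly ("the free group on `r` generators
`f_1, …, f_r`", [DettweilerReiter2007, §2.1]) and without which the statement is false
(`not_DettweilerReiter2007_irreducible`: for `r = 0`, `MC_λ` of the irreducible `1`-dimensional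
module is `0`). [cite: DettweilerReiter2007, Theorem 2.4 (iii)] -/
def DettweilerReiter2007_irreducible_pos : Prop :=
  ∀ (K : Type v) [Field K] (V : Type w) [AddCommGroup V] [Module K V] [FiniteDimensional K V]
    (r : ℕ) (ρ : Representation K (FreeGroup (Fin r)) V) (l : Kˣ),
    0 < r → CondStar ρ → CondStarStar ρ → ρ.IsIrreducible → (middleConvolution ρ l).IsIrreducible

/-- **Discharge of `DettweilerReiter2007_irreducible_pos`** [DettweilerReiter2007, Thm. 2.4 (iii)],
from `MiddleConvolution.isIrreducible_middleConvolution` (which does not even use `(∗∗)`).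
[cite: DettweilerReiter2007, Theorem 2.4 (iii)] -/
theorem DettweilerReiter2007_irreducible_pos_holds : DettweilerReiter2007_irreducible_pos := by
  intro K _ V _ _ _ r ρ l hr hstar _ hirr
  haveI : Nonempty (Fin r) := ⟨⟨0, hr⟩⟩
  exact isIrreducible_middleConvolution ρ l hstar hirr

end NamedFacts

end Literature.AlgebraicGeometry.Motives

end
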